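import Summits.CriticalPhenomena.CardyFormulaZ2.Theorems.CardySelfRefinementCriticalPathRSWStubPhaseDiagramLandmarksBTransfer
import Literature.Probability.Percolation.IsoradialProofs

/-!
# Stub `stub_phaseDiagramLandmarksB` of line `finite-size-envelope` (crux `CriticalPathRSW`)

Route `CardySelfRefinement`, crux `CriticalPathRSW` (stmt-CriticalPhenomena-10267), line
`finite-size-envelope`: the registered stub `stub_phaseDiagramLandmarksB` — landmarks of the
finite-size phase diagram of the self-refinement family `M_k(ρ, c)` (`selfRefinementMeasure`,
`Literature/Probability/Percolation/SelfRefinementMeasure.lean`), `k = 2, 3`: two-sided crossing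
certificates at all scales `n ≥ n₂` at the endpoints `(1, 0)` (bond-`kℤ²` at `½`, subdivided) and
`(0, ½)` (bond-`ℤ²` at `½`), and the hard-way bound `≤ 1 - ε₂` along the whole bottom edge `c = 0`.

Contents (the measure-theoretic half; the lattice combinatorics is in the two helper files
`…StubPhaseDiagramLandmarksBPathLift`, `…StubPhaseDiagramLandmarksBTransfer`):
* `bondPercolation_real_crossing`: the box crossing `KST2023.crossing m n` of `[-m, m] × [-n, n]` has
  `P_p`-probability `crossingProb p (2m) (2n)` (translation to the rectangle `[0, 2m] × [0, 2n]`);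
* `real_crossing_le_selfRefinementMeasure_one_zero`: `P_{1/2}(𝓒(a, b)) ≤ M_k(1, 0)(𝓒(ka, kb))`
  (`selfRefinementMeasure_one_zero` + subdivision);
* `selfRefinementMeasure_map_coarsen`: for every `ρ, c` and `k ≠ 0` the coarse configuration
  "the first sub-edge `(k u, d)` of the tuple `(u, d)` is open" has law `P_{1/2}` — that sub-edge is
  open iff (selector and shared coin) or (no selector and own coin), a fair bit whatever the
  selector bias, over disjoint blocks of coins (`prodBernoulli_map_blockProp`: curry +
  `Measure.infinitePi_map_pi`, as in the tree's `prodBernoulli_map_blockMap`);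
* `selfRefinementMeasure_real_crossing_le`: on the bottom edge (interior edges a.s. closed)
  `M_k(ρ, 0)(𝓒(ka, kb)) ≤ P_{1/2}(𝓒(a, b))`, `k ≥ 2`, `a ≥ 1` (fine-to-coarse transfer + the law above);
* `stub_phaseDiagramLandmarksB`: ℤ²-RSW at `p = ½` (`exists_le_crossingProb_of_le_mul`,
  `exists_crossingProb_le_of_le_mul`, i.e. `rsw_half_holds`) for the boxes `[-m, m] × [-3m, 3m]`,
  `[-3m, 3m] × [-m, m]`, transported by the items above and `selfRefinementMeasure_zero_half`.

References: Russo 1978, Seymour–Welsh 1978, Grimmett 1999 §1.3, §11.7; Beffara 2008 §5.1–5.2;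
Köhler-Schindler–Tassion 2023 §1 (the boxes `R(m, n)`).
-/

namespace Summit.CriticalPhenomena.CardyFormulaZ2.Cruxes.CriticalPathRSW.FiniteSizeEnvelope

open Set
open Literature.Probability.LatticeModels Literature.Probability.Percolation
open MeasureTheory ProbabilityTheory Filter Topology
open scoped ENNReal

/-! ### Box crossings of `P_{1/2}` are rectangle crossings -/

/-- `KST2023.crossing m n` (the box `[-m, m] × [-n, n]`) is the translate by `(-m, -n)` of the tree's
`lrCrossing (2m) (2n)` (the rectangle `[0, 2m] × [0, 2n]`), so under `P_p` its probability is
`crossingProb p (2m) (2n)`. [folklore] -/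
theorem bondPercolation_real_crossing (p : unitInterval) (m n : ℕ) :
    (bondPercolation (zdGraph 2) p).real (KST2023.crossing m n) = crossingProb p (2 * m) (2 * n) := by
  set v : Site 2 := ![-(m : ℤ), -(n : ℤ)] with hv
  have hv0 : ∀ x : Site 2, (x + -v) 0 = x 0 + m := fun x => by simp [hv]
  have hv1 : ∀ x : Site 2, (x + -v) 1 = x 1 + n := fun x => by simp [hv]
  have hbox : ∀ x : Site 2, x + -v ∈ rectangle (2 * m) (2 * n) ↔ x ∈ KST2023.box m n := by
    intro x
    rw [mem_rectangle_iff, mem_box_iff', hv0, hv1]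
    push_cast
    omega
  have hrect : (fun x : Site 2 => x + -v) ⁻¹' (↑(rectangle (2 * m) (2 * n)) : Set (Site 2)) =
      KST2023.box m n := by
    ext x
    rw [mem_preimage, Finset.mem_coe]
    exact hbox x
  have hleft : (fun x : Site 2 => x + -v) ⁻¹' (↑(leftSide (2 * m) (2 * n)) : Set (Site 2)) =
      {x | x ∈ KST2023.box m n ∧ x 0 = -(m : ℤ)} := by
    ext x
    rw [mem_preimage, Finset.mem_coe, leftSide, Finset.mem_filter, hbox x, mem_setOf_eq, hv0]
    constructor <;> rintro ⟨h1, h2⟩ <;> exact ⟨h1, by omega⟩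
  have hright : (fun x : Site 2 => x + -v) ⁻¹' (↑(rightSide (2 * m) (2 * n)) : Set (Site 2)) =
      {x | x ∈ KST2023.box m n ∧ x 0 = m} := by
    ext x
    rw [mem_preimage, Finset.mem_coe, rightSide, Finset.mem_filter, hbox x, mem_setOf_eq, hv0]
    push_cast
    constructor <;> rintro ⟨h1, h2⟩ <;> exact ⟨h1, by omega⟩
  rw [crossingProb, lrCrossing, ← real_openCrossing_shift p v, Set.image_add_right, Set.image_add_right,
    Set.image_add_right, hrect, hleft, hright]
  rfl

/-! ### The endpoint `(1, 0)`: lower bound by subdivision -/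

/-- **`M_k(1, 0)` crosses the fine box at least as easily as `P_{1/2}` crosses the coarse box**:
`P_{1/2}(𝓒(a, b)) ≤ M_k(1,0)(𝓒(ka, kb))`, since `M_k(1,0) = P_{1/2} ∘ (refineConfig k)⁻¹` and a
coarse crossing subdivides into a fine one. [folklore] -/
theorem real_crossing_le_selfRefinementMeasure_one_zero {k : ℕ} (hk : 0 < k) (a b : ℕ) :
    (bondPercolation (zdGraph 2) half).real (KST2023.crossing a b) ≤
      (selfRefinementMeasure k 1 0).real (KST2023.crossing (k * a) (k * b)) := by
  have hmeas : MeasurableSet (KST2023.crossing (k * a) (k * b)) := measurableSet_openCrossing_of_countable _ _ _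
  rw [selfRefinementMeasure_one_zero, map_measureReal_apply (measurable_refineConfig k) hmeas]
  simp only [measureReal_def]
  refine ENNReal.toReal_mono (measure_ne_top _ _) (measure_mono_ae ?_)
  filter_upwards [ae_subset_edgeSet (zdGraph 2) half] with ω hω h
  exact refineConfig_mem_crossing hk hω h

/-! ### The law of the first sub-edges of the tuples: fair and independent -/

/-- **A three-coin block collapsed to one coin.** On `{0,1}³` with independent coins of
parameters `r, ½, ½`, the bit "if coin 0 then coin 1 else coin 2" is a fair coin. [folklore] -/
theorem pi_three_map_select (r : unitInterval) :
    (Measure.pi fun j : Fin 3 => (Ber(True, False, if j = 0 then r else half) : Measure Prop)).map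
      (fun g : Fin 3 → Prop => (g 0 ∧ g 1) ∨ (¬ g 0 ∧ g 2)) = Ber(True, False, half) := by
  ext s hs
  rw [Measure.map_apply (measurable_of_countable _) hs]
  set t₁ : Fin 3 → Set Prop := fun j => if j = 0 then {True} else if j = 1 then s else univ with ht₁
  set t₂ : Fin 3 → Set Prop := fun j => if j = 0 then {False} else if j = 1 then univ else s with ht₂
  have hpre : (fun g : Fin 3 → Prop => (g 0 ∧ g 1) ∨ (¬ g 0 ∧ g 2)) ⁻¹' s =
      Set.pi univ t₁ ∪ Set.pi univ t₂ := by
    ext g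
    simp only [mem_preimage, mem_union, mem_univ_pi, ht₁, ht₂]
    by_cases h0 : g 0
    · have e : ((g 0 ∧ g 1) ∨ (¬ g 0 ∧ g 2)) = g 1 := propext (by tauto)
      rw [e]
      constructor
      · intro hg
        left
        intro j
        fin_cases j <;> simp [h0, hg]
      · rintro (h | h)
        · simpa using h 1
        · exact absurd (by simpa using h 0) (not_not.2 h0)
    · have e : ((g 0 ∧ g 1) ∨ (¬ g 0 ∧ g 2)) = g 2 := propext (by tauto)
      rw [e]
      constructor
      · intro hg
        right
        intro j
        fin_cases j <;> simp [h0, hg]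
      · rintro (h | h)
        · exact absurd (by simpa using h 0) h0
        · simpa using h 2
  have hdisj : Disjoint (Set.pi univ t₁) (Set.pi univ t₂) := by
    rw [Set.disjoint_left]
    intro g h1 h2
    have a := h1 0 (mem_univ _)
    have b := h2 0 (mem_univ _)
    simp only [ht₁, ht₂, if_true, mem_singleton_iff] at a b
    rw [a] at b
    exact true_ne_false b
  rw [hpre, measure_union hdisj (Set.to_countable _).measurableSet, Measure.pi_pi, Measure.pi_pi,
    Fin.prod_univ_three, Fin.prod_univ_three]
  simp only [ht₁, ht₂, Fin.isValue, if_true, one_ne_zero, if_false, Fin.reduceEq, measure_univ, mul_one,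
    bernoulliMeasure_prop_apply_true, bernoulliMeasure_prop_apply_false]
  rw [← add_mul, ← ENNReal.ofReal_add r.2.1 (sub_nonneg.2 r.2.2), add_sub_cancel, ENNReal.ofReal_one, one_mul]

/-- **Collapsing independent three-coin blocks.** If at every `v` the Boolean function `φ` of the
block `(v, 0), (v, 1), (v, 2)` of coins of `prodBernoulli P` has the Bernoulli law of parameter
`q v`, then the random set `{v | φ(block v)}` has law `prodBernoulli q` (curry the product over
`ι × Fin 3`, `Measure.infinitePi_map_curry`, and push `φ` through the outer product,
`Measure.infinitePi_map_pi`; same skeleton as the tree's `prodBernoulli_map_blockMap`).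
[folklore] -/
theorem prodBernoulli_map_blockProp {ι : Type*} (P : ι × Fin 3 → unitInterval) (q : ι → unitInterval)
    (φ : (Fin 3 → Prop) → Prop)
    (hφ : ∀ v, (Measure.pi fun j : Fin 3 => (Ber(True, False, P (v, j)) : Measure Prop)).map φ =
      Ber(True, False, q v)) :
    (prodBernoulli P).map (fun S => {v | φ (fun j => (v, j) ∈ S)}) = prodBernoulli q := by
  have hφm : Measurable φ := measurable_of_countable φ
  have hΨ : Measurable (fun (h : ι → Fin 3 → Prop) (v : ι) => φ (h v)) :=
    measurable_pi_lambda _ fun v => hφm.comp (measurable_pi_apply v)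
  have hC : Measurable (MeasurableEquiv.curry ι (Fin 3) Prop) := MeasurableEquiv.measurable _
  have hG : Measurable (fun S : Set (ι × Fin 3) => {v | φ (fun j => (v, j) ∈ S)}) :=
    measurable_set_iff.2 fun v => hφm.comp (measurable_pi_lambda _ fun j => measurable_set_mem _)
  have hcomp : (fun S : Set (ι × Fin 3) => {v | φ (fun j => (v, j) ∈ S)}) ∘
      (fun g : ι × Fin 3 → Prop => {x | g x}) =
        (fun g : ι → Prop => {v | g v}) ∘ (fun (h : ι → Fin 3 → Prop) (v : ι) => φ (h v)) ∘
          (MeasurableEquiv.curry ι (Fin 3) Prop) := by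
    funext g
    rfl
  have hcurry : (Measure.infinitePi fun x : ι × Fin 3 =>
      (unitInterval.toNNReal (P x) • Measure.dirac True +
        unitInterval.toNNReal (unitInterval.symm (P x)) • Measure.dirac False : Measure Prop)).map
        (MeasurableEquiv.curry ι (Fin 3) Prop) =
      Measure.infinitePi fun i : ι => Measure.infinitePi fun j : Fin 3 => Ber(True, False, P (i, j)) :=
    Measure.infinitePi_map_curry (fun (i : ι) (j : Fin 3) => Ber(True, False, P (i, j)))
  have hpush : (Measure.infinitePi fun i : ι =>
      Measure.infinitePi fun j : Fin 3 => Ber(True, False, P (i, j))).map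
        (fun (h : ι → Fin 3 → Prop) (v : ι) => φ (h v)) =
      Measure.infinitePi fun i : ι =>
        (Measure.infinitePi fun j : Fin 3 => Ber(True, False, P (i, j))).map φ :=
    Measure.infinitePi_map_pi _ (fun _ => hφm)
  have hfac : (fun i : ι => (Measure.infinitePi fun j : Fin 3 => Ber(True, False, P (i, j))).map φ) =
      fun i : ι => (Ber(True, False, q i) : Measure Prop) := by
    funext i
    rw [Measure.infinitePi_eq_pi]
    exact hφ i
  rw [prodBernoulli_eq_map P, Measure.map_map hG measurable_setOf, hcomp,
    ← Measure.map_map measurable_setOf (hΨ.comp hC), ← Measure.map_map hΨ hC, hcurry, hpush, hfac,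
    prodBernoulli_eq_map q]
  rfl

/-- The coarse vertex `k u` has multiples of `k` as coordinates: the edge `(k u, d)` is axial. [folklore] -/
theorem isAxialEdge_smul (k : ℕ) (t : Site 2 × Fin 2) : IsAxialEdge k ((k : ℤ) • t.1, t.2) := by
  obtain ⟨u, d⟩ := t
  fin_cases d <;> simp [IsAxialEdge]

/-- The tuple of the first sub-edge `(k u, d)` of the coarse edge `(u, d)` is based at `u` (`k ≠ 0`). [folklore] -/
theorem tupleBase_smul {k : ℕ} (hk : k ≠ 0) (t : Site 2 × Fin 2) : tupleBase k ((k : ℤ) • t.1, t.2) = t.1 := by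
  have hk' : (k : ℤ) ≠ 0 := by exact_mod_cast hk
  funext i
  simp only [tupleBase_apply, Pi.smul_apply, smul_eq_mul]
  exact Int.mul_ediv_cancel_left _ hk'

/-- **The coins of a tuple block are distinct across blocks**: the map sending `((u, d), 0)` to the
selector `(u, d, 2)`, `((u, d), 1)` to the shared coin `(u, d, 1)` and `((u, d), 2)` to the own coin
`(k u, d, 0)` of the first sub-edge is injective (`k ≠ 0`). [folklore] -/
theorem blockCoin_injective {k : ℕ} (hk : k ≠ 0) :
    Function.Injective (fun q : (Site 2 × Fin 2) × Fin 3 =>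
      (if q.2 = 0 then (q.1.1, q.1.2, (2 : Fin 3)) else if q.2 = 1 then (q.1.1, q.1.2, (1 : Fin 3))
        else ((k : ℤ) • q.1.1, q.1.2, (0 : Fin 3)) : Site 2 × Fin 2 × Fin 3)) := by
  have hk' : (k : ℤ) ≠ 0 := by exact_mod_cast hk
  rintro ⟨⟨u, d⟩, j⟩ ⟨⟨u', d'⟩, j'⟩ h
  fin_cases j <;> fin_cases j' <;>
    simp only [Fin.zero_eta, Fin.mk_one, Fin.reduceFinMk, Fin.isValue, if_true, one_ne_zero, if_false,
      Fin.reduceEq, Prod.mk.injEq] at h ⊢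
  · exact ⟨⟨h.1, h.2.1⟩, trivial⟩
  · exact absurd h.2.2 (by decide)
  · exact absurd h.2.2 (by decide)
  · exact absurd h.2.2 (by decide)
  · exact ⟨⟨h.1, h.2.1⟩, trivial⟩
  · exact absurd h.2.2 (by decide)
  · exact absurd h.2.2 (by decide)
  · exact absurd h.2.2 (by decide)
  · exact ⟨⟨smul_right_injective (Site 2) hk' h.1, h.2.1⟩, trivial⟩

/-- **The coarse configuration of the first sub-edges, in coins.** Under the configuration map of
`M_k`, the coarse edge `(u, d)` whose FIRST sub-edge `(k u, d)` is open is read off the block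
`(selector, shared coin, own coin of (k u, d))`: open iff (selector and shared) or (no selector
and own). [folklore] -/
theorem coarsen_refinementConfig {k : ℕ} (hk : k ≠ 0) (S : Set (Site 2 × Fin 2 × Fin 3)) :
    edgeConfig {t : Site 2 × Fin 2 | cornerEdge ((k : ℤ) • t.1, t.2) ∈ refinementConfig k S} =
      edgeConfig {t : Site 2 × Fin 2 | (fun g : Fin 3 → Prop => (g 0 ∧ g 1) ∨ (¬ g 0 ∧ g 2))
        (fun j => (t, j) ∈ (fun q : (Site 2 × Fin 2) × Fin 3 =>
          (if q.2 = 0 then (q.1.1, q.1.2, (2 : Fin 3)) else if q.2 = 1 then (q.1.1, q.1.2, (1 : Fin 3))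
            else ((k : ℤ) • q.1.1, q.1.2, (0 : Fin 3)) : Site 2 × Fin 2 × Fin 3)) ⁻¹' S)} := by
  congr 1
  ext t
  simp only [mem_setOf_eq, cornerEdge_mem_refinementConfig_iff, mem_preimage,
    refinementOpen_of_isAxialEdge S (isAxialEdge_smul k t), tupleBase_smul hk t]
  simp

/-- **The first sub-edges of the tuples of `M_k(ρ, c)` form Bernoulli(½) bond percolation on the
coarse lattice** (`k ≠ 0`, any `ρ`, `c`): the image of `M_k(ρ, c)` under
`ω ↦ {(u, d) | the sub-edge (k u, d) is open in ω}` (drawn on `ℤ²`) is `P_{1/2}`. Indeed the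
sub-edge `(k u, d)` is open iff (selector on and shared coin on) or (selector off and own coin on),
a fair bit whatever the selector bias `ρ`, and these bits use disjoint blocks of coins. [folklore] -/
theorem selfRefinementMeasure_map_coarsen {k : ℕ} (hk : k ≠ 0) (ρ c : ℝ) :
    (selfRefinementMeasure k ρ c).map
        (fun ω : BondConfig (Site 2) => edgeConfig {t : Site 2 × Fin 2 | cornerEdge ((k : ℤ) • t.1, t.2) ∈ ω}) =
      bondPercolation (zdGraph 2) half := by
  set F : (Site 2 × Fin 2) × Fin 3 → Site 2 × Fin 2 × Fin 3 := fun q =>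
    if q.2 = 0 then (q.1.1, q.1.2, (2 : Fin 3)) else if q.2 = 1 then (q.1.1, q.1.2, (1 : Fin 3))
      else ((k : ℤ) • q.1.1, q.1.2, (0 : Fin 3)) with hF
  set φ : (Fin 3 → Prop) → Prop := fun g => (g 0 ∧ g 1) ∨ (¬ g 0 ∧ g 2) with hφ
  have hCm : Measurable (fun ω : BondConfig (Site 2) =>
      edgeConfig {t : Site 2 × Fin 2 | cornerEdge ((k : ℤ) • t.1, t.2) ∈ ω}) :=
    measurable_edgeConfig.comp (measurable_set_iff.2 fun t => measurable_set_mem _)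
  have hGm : Measurable (fun R : Set ((Site 2 × Fin 2) × Fin 3) => {t : Site 2 × Fin 2 | φ (fun j => (t, j) ∈ R)}) :=
    measurable_set_iff.2 fun t =>
      (measurable_of_countable φ).comp (measurable_pi_lambda _ fun j => measurable_set_mem _)
  have hFm : Measurable (fun S : Set (Site 2 × Fin 2 × Fin 3) => F ⁻¹' S) :=
    measurable_set_iff.2 fun q => measurable_set_mem _
  have hfac : (fun ω : BondConfig (Site 2) =>
      edgeConfig {t : Site 2 × Fin 2 | cornerEdge ((k : ℤ) • t.1, t.2) ∈ ω}) ∘ refinementConfig k =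
        (edgeConfig ∘ (fun R : Set ((Site 2 × Fin 2) × Fin 3) => {t : Site 2 × Fin 2 | φ (fun j => (t, j) ∈ R)})) ∘
          (fun S : Set (Site 2 × Fin 2 × Fin 3) => F ⁻¹' S) := by
    funext S
    simp only [Function.comp_apply]
    exact coarsen_refinementConfig hk S
  have hparam2 : ∀ t : Site 2 × Fin 2, refinementParam k ρ c (F (t, 2)) = half := by
    intro t
    have hF2 : F (t, 2) = ((k : ℤ) • t.1, t.2, (0 : Fin 3)) := by
      rw [hF]
      dsimp only
      rw [if_neg (by decide), if_neg (by decide)]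
    rw [hF2]
    exact refinementParam_apply_zero_of_isAxialEdge ρ c (isAxialEdge_smul k t)
  have hpar : ∀ t : Site 2 × Fin 2,
      (fun j : Fin 3 => (Ber(True, False, refinementParam k ρ c (F (t, j))) : Measure Prop)) =
        (fun j : Fin 3 => (Ber(True, False, (if j = 0 then Set.projIcc (0 : ℝ) 1 zero_le_one ρ else half)) :
          Measure Prop)) := by
    intro t
    funext j
    fin_cases j
    · simp [hF]
    · simp [hF]
    · show (Ber(True, False, refinementParam k ρ c (F (t, 2))) : Measure Prop) =
        Ber(True, False, (if (2 : Fin 3) = 0 then Set.projIcc (0 : ℝ) 1 zero_le_one ρ else half))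
      rw [hparam2 t, if_neg (by decide)]
  have hblock : (prodBernoulli fun q => refinementParam k ρ c (F q)).map
      (fun R : Set ((Site 2 × Fin 2) × Fin 3) => {t : Site 2 × Fin 2 | φ (fun j => (t, j) ∈ R)}) =
        prodBernoulli (fun _ : Site 2 × Fin 2 => half) :=
    prodBernoulli_map_blockProp _ _ φ (fun t => by
      show Measure.map φ (Measure.pi fun j : Fin 3 =>
          (Ber(True, False, refinementParam k ρ c (F (t, j))) : Measure Prop)) = Ber(True, False, half)
      rw [hpar t, hφ]
      exact pi_three_map_select _)
  rw [selfRefinementMeasure_def, Measure.map_map hCm (measurable_refinementConfig k), hfac,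
    ← Measure.map_map (measurable_edgeConfig.comp hGm) hFm,
    prodBernoulli_map_preimage _ (blockCoin_injective hk), ← Measure.map_map measurable_edgeConfig hGm,
    hblock, prodBernoulli_const, setBernoulli_univ_map_edgeConfig]

/-! ### The bottom edge `c = 0`: upper bound by coarse-graining -/

/-- At `c = 0`, almost surely every open edge of the configuration is axial. [folklore] -/
theorem ae_open_isAxialEdge (k : ℕ) (ρ : ℝ) :
    ∀ᵐ S ∂prodBernoulli (refinementParam k ρ 0),
      ∀ e : Site 2 × Fin 2, cornerEdge e ∈ refinementConfig k S → IsAxialEdge k e := by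
  filter_upwards [ae_forall_interior_notMem k ρ] with S hS e he
  by_contra hax
  rw [cornerEdge_mem_refinementConfig_iff, refinementOpen_of_not_isAxialEdge S hax] at he
  exact hS e hax he

/-- **On the bottom edge the fine box is crossed the hard way at most as easily as `P_{1/2}` crosses
the coarse box**: `M_k(ρ, 0)(𝓒(ka, kb)) ≤ P_{1/2}(𝓒(a, b))` for `k ≥ 2`, `a ≥ 1` and every `ρ`.
Interior edges are a.s. closed, so a fine crossing runs along fully open tuples
(`coarse_mem_crossing_of_fine`), in particular along tuples whose first sub-edge is open, and
those form a `P_{1/2}` bond percolation on the coarse lattice (`selfRefinementMeasure_map_coarsen`).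
[folklore] -/
theorem selfRefinementMeasure_real_crossing_le {k a : ℕ} (hk : 2 ≤ k) (ha : 1 ≤ a) (ρ : ℝ) (b : ℕ) :
    (selfRefinementMeasure k ρ 0).real (KST2023.crossing (k * a) (k * b)) ≤
      (bondPercolation (zdGraph 2) half).real (KST2023.crossing a b) := by
  have hk0 : k ≠ 0 := by omega
  have hCm : Measurable (fun ω : BondConfig (Site 2) =>
      edgeConfig {t : Site 2 × Fin 2 | cornerEdge ((k : ℤ) • t.1, t.2) ∈ ω}) :=
    measurable_edgeConfig.comp (measurable_set_iff.2 fun t => measurable_set_mem _)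
  have hmeas : ∀ m n : ℕ, MeasurableSet (KST2023.crossing m n) := fun _ _ =>
    measurableSet_openCrossing_of_countable _ _ _
  rw [← selfRefinementMeasure_map_coarsen hk0 ρ 0, map_measureReal_apply hCm (hmeas a b),
    selfRefinementMeasure_real_apply k ρ 0 (hmeas _ _), selfRefinementMeasure_real_apply k ρ 0 (hCm (hmeas a b))]
  simp only [measureReal_def]
  refine ENNReal.toReal_mono (measure_ne_top _ _) (measure_mono_ae ?_)
  filter_upwards [ae_open_isAxialEdge k ρ] with S hS h
  refine coarse_mem_crossing_of_fine hk ha (refinementConfig_subset_edgeSet k S) hS (fun u d hall => ?_) h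
  have h0 := hall 0 (by omega)
  simp only [Nat.cast_zero, Pi.single_zero, add_zero, zero_add] at h0
  exact (cornerEdge_mem_edgeConfig_iff _ (u, d)).2 h0

/-- **Stub `stub_phaseDiagramLandmarksB` of line `finite-size-envelope`** (crux `CriticalPathRSW`,
stmt-CriticalPhenomena-10267): the landmarks of the finite-size phase diagram of the
self-refinement family `M_k(ρ, c)`, `k = 2, 3`. With `ε₂ = min(c₁, c₂)` the two ℤ²-RSW constants
of `P_{1/2}` at aspect ratio `1` (`exists_le_crossingProb_of_le_mul`,
`exists_crossingProb_le_of_le_mul`, monotone in the sides) and `n₂ = 1`, for every `n ≥ n₂`: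
* at the endpoint `(1, 0)` (bond-`kℤ²` at `½`, subdivided: `selfRefinementMeasure_one_zero`) the
  easy-way box `[-kn, kn] × [-3kn, 3kn]` is crossed with probability `≥ ε₂` (a coarse crossing
  subdivides, `real_crossing_le_selfRefinementMeasure_one_zero`) and the hard-way box
  `[-3kn, 3kn] × [-kn, kn]` with probability `≤ 1 - ε₂` (the case `ρ = 1` of the bottom edge);
* at the endpoint `(0, ½)` (`M_k(0, ½) = P_{1/2}`, `selfRefinementMeasure_zero_half`) the same two
  bounds are ℤ²-RSW at scale `kn`;
* on the bottom edge `(ρ, 0)`, `ρ ∈ [0, 1]` (indeed for every `ρ`), the hard-way crossing has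
  probability `≤ 1 - ε₂`: interior edges are closed, a fine crossing runs through fully open
  tuples, and the tuples whose first sub-edge is open form a `P_{1/2}` bond percolation of the
  coarse lattice (`selfRefinementMeasure_real_crossing_le`). [folklore] -/
theorem stub_phaseDiagramLandmarksB :
  ∀ k : ℕ, k = 2 ∨ k = 3 →
    ∃ ε₂ > 0, ∃ n₂ : ℕ, 1 ≤ n₂ ∧ ∀ n : ℕ, n₂ ≤ n →
      (ε₂ ≤ (selfRefinementMeasure k 1 0).real (KST2023.crossing (k * n) (3 * (k * n))) ∧
        (selfRefinementMeasure k 1 0).real (KST2023.crossing (3 * (k * n)) (k * n)) ≤ 1 - ε₂) ∧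
      (ε₂ ≤ (selfRefinementMeasure k 0 (1 / 2)).real (KST2023.crossing (k * n) (3 * (k * n))) ∧
        (selfRefinementMeasure k 0 (1 / 2)).real (KST2023.crossing (3 * (k * n)) (k * n)) ≤ 1 - ε₂) ∧
      (∀ ρ : ℝ, 0 ≤ ρ → ρ ≤ 1 →
        (selfRefinementMeasure k ρ 0).real (KST2023.crossing (3 * (k * n)) (k * n)) ≤ 1 - ε₂) := by
  intro k hk
  have hk2 : 2 ≤ k := by rcases hk with rfl | rfl <;> norm_num
  have hk0 : 0 < k := by omega
  obtain ⟨c₁, hc₁, h₁⟩ := exists_le_crossingProb_of_le_mul (k := 1) le_rfl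
  obtain ⟨c₂, hc₂, h₂⟩ := exists_crossingProb_le_of_le_mul (k := 1) le_rfl
  -- ℤ²-RSW at `p = 1/2` for the boxes `[-m, m] × [-3m, 3m]` (easy) and `[-3m, 3m] × [-m, m]` (hard)
  have hlow : ∀ m : ℕ, 1 ≤ m →
      min c₁ c₂ ≤ (bondPercolation (zdGraph 2) half).real (KST2023.crossing m (3 * m)) := by
    intro m hm
    rw [bondPercolation_real_crossing]
    exact (min_le_left _ _).trans (h₁ (2 * m) (2 * (3 * m)) (by omega) (by omega))
  have hup : ∀ m : ℕ, 1 ≤ m →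
      (bondPercolation (zdGraph 2) half).real (KST2023.crossing (3 * m) m) ≤ 1 - min c₁ c₂ := by
    intro m hm
    rw [bondPercolation_real_crossing]
    exact (h₂ (2 * (3 * m)) (2 * m) (by omega) (by omega)).trans (by linarith [min_le_right c₁ c₂])
  have h3 : ∀ n : ℕ, k * (3 * n) = 3 * (k * n) := fun n => by ring
  refine ⟨min c₁ c₂, lt_min hc₁ hc₂, 1, le_rfl, fun n hn => ⟨⟨?_, ?_⟩, ⟨?_, ?_⟩, fun ρ _ _ => ?_⟩⟩
  · have h := real_crossing_le_selfRefinementMeasure_one_zero hk0 n (3 * n)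
    rw [h3] at h
    exact (hlow n hn).trans h
  · have h := selfRefinementMeasure_real_crossing_le hk2 (show 1 ≤ 3 * n by omega) 1 n
    rw [h3] at h
    exact h.trans (hup n hn)
  · rw [selfRefinementMeasure_zero_half]
    exact hlow (k * n) (mul_pos hk0 (by omega))
  · rw [selfRefinementMeasure_zero_half]
    exact hup (k * n) (mul_pos hk0 (by omega))
  · have h := selfRefinementMeasure_real_crossing_le hk2 (show 1 ≤ 3 * n by omega) ρ n
    rw [h3] at h
    exact h.trans (hup n hn)

end Summit.CriticalPhenomena.CardyFormulaZ2.Cruxes.CriticalPathRSW.FiniteSizeEnvelope
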